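import Mathlib
import Literature.MathematicalPhysics.QuantumFieldTheory.Balaban1983to89.B2Eq29Resummation
import Literature.MathematicalPhysics.QuantumFieldTheory.Balaban1983to89.B2Sect3C

/-!
# `Balaban1983to89.B2Eq341Zeta` — T. Bałaban, *(Higgs)₂,₃ quantum fields in a finite volume. II. An upper bound*,
Commun. Math. Phys. **86** (1982) 555–594 [Balaban1982Higgs2]: the small-factor sums ζ′_{Λ₀^{(k)}} (3.34) p. 591 and
ζ″_{Λ₀^{(k)}} (3.41) p. 592 TYPED WITH BODIES over the admissible/minimal-tuple dictionary of `B2Eq29Resummation`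
((2.7)/(2.9)), and the combinatorial inputs of Sect. 3.C PROVED in that dictionary: the covering counts (3.44)/(3.45)
from admissibility, and (3.46) ζ″ ≤ 2^{#tuple elements} exp(−c₀p(L^kε)²|𝒞_k|)

statement-level skeleton of published theorems with citation tags; proofs where landed; nothing here is a claim about the Yang–Mills mass gap

PDF held: `paper:balaban1982-cmp86-higgs23-ii` (journal page = PDF page + 554); (3.34), (3.41)–(3.46) read from the ×2
renders `run/shared/lean/pub/pub-balaban/b2b-balaban-ref1/pages/1982-cmp86-higgs23-II/1982-cmp86-higgs23-II-p037-x2.png`,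
`…-p038-x2.png`, `…-p039-x2.png` (pp. 591–593).

WHAT IS REPRODUCED.  Members of SKELETON rows **B2.Eq3.32** ((3.34) ζ′, before: `absent`), **B2.Eq3.42** ((3.41) ζ″,
before: the abstract per-scale VALUE `B2.Run.zeta`, `typed-existing`) and **B2.Eq3.47** ((3.44)/(3.45)/(3.46), before:
kernel-checked in `B2Sect3C` for an explicit Euclidean cube model with the tuple elements as points — here the
ADMISSIBILITY-driven half: why EVERY admissible tuple covers 𝒞).  TYPED with bodies: `zeta341` = (3.41) and `zeta334`
= (3.34) as finite sums over the minimal admissible tuples (`B2Eq29Resummation.minimals`) of products of per-element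
factors, the six sorts P_v, Q_v, R_v, P_s, Q_s, R_s carried by `sort : S → Fin 6` (dictionary 0 ↦ P_v, 1 ↦ Q_v,
2 ↦ R_v, 3 ↦ P_s, 4 ↦ Q_s, 5 ↦ R_s) and the printed coefficients ⅛a, ¼γ₀, ¼γ₀, ⅛a, ¼γ₀, 1 by `coef341`.  PROVED:
`prod_weight341` (each summand of (3.41) IS the printed six-exponential `B2Sect3C.term341` of the sort counts of the
tuple), `card_cover_le` ((3.44)/(3.45): for an ADMISSIBLE tuple τ the cubes meeting Λ₀^c number ≤ 3^d·|τ| — because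
Λ₀^c = ⋃_{x∈τ}(large blocks within r(ε) of x) by admissibility and each block near x lies in one of the 3^d cubes around
x), `term341_le_of_admissible`, `card_minimals_le_two_pow` and **`zeta341_le`** ((3.46): ζ″_{Λ₀^{(k)}} ≤ 2^{#outer}·
exp(−c₀p(L^kε)²|𝒞_k|) with the printed c₀ = `B2.c0 a γ₀ d`), `zeta334_le_zeta341_of` (ζ′ ↦ ζ″ once the vector-field
indicators are traded for their small factors, as on p. 591–592).  KERNEL: finite sums; `B2Sect3C.term341_le`
supplies the exponent arithmetic of (3.46).  NOT HERE: the cube geometry itself (that the cubes around an element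
are ≤ 3^d and contain every large block within r(ε) of it is the HYPOTHESIS `hnear`/`hcard` — its Euclidean model is
`B2Sect3C.near_mem_nbhd`/`card_nbhd_le`), the corridor construction (3.48)–(3.52), the integrals producing the small
factors ((3.31), (3.33): `B2Sect3BSmallFactors`; (2.13): `B2Ineq213SmallFactors`).

Unit `lit-balaban-r14` gen 3 (reader/typer of B1–B2), HOME `run/shared/lean/pub/lit-balaban/`.

THE SOURCE TEXT, verbatim.  p. 591 [PDF 37]: *"Thus, defining the functions ζ′_{Λ₀^{(k)}} = Σ_{{P_v^{(k)},…,R_s^{(k)}}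
admissible, minimal} χ^c_{P_v^{(k)}}·χ^c_{Q_v^{(k)}}χ^c_{R_v^{(k)}} exp(−⅛ap(L^kε)²|P_s^{(k)}|)·exp(−¼γ₀p(L^kε)²|Q_s^{(k)}|)
exp(−p(L^kε)²|R_s^{(k)}|), (3.34) we get the inequality …"*.  p. 592 [PDF 38]: *"where ζ″_{Λ₀^{(k)}} = Σ_{{P_v^{(k)},…,
R_s^{(k)}} admissible, minimal} ·exp(−⅛ap(L^kε)²|P_v^{(k)}|)exp(−¼γ₀p(L^kε)²|Q_v^{(k)}|)·exp(−¼γ₀p(L^kε)²|R_v^{(k)}|)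
exp(−⅛ap(L^kε)²|P_s^{(k)}|)·exp(−¼γ₀p(L^kε)²|Q_s^{(k)}|)exp(−p(L^kε)²|R_s^{(k)}|). (3.41) … Let us consider a regular
partition of T₁ into a lattice of cubes, each cube is a sum of large blocks and a length of its side is bigger r(ε),
and less 2r(ε). Let us define 𝒞₀ as the set of the cubes having common points with Λ₀^{(0)c}. Thus Λ₀^{(0)c} ⊂
⋃_{□∈𝒞₀}□ = ∪𝒞₀. (3.43) Now if to every element of the set P_v^{(0)} ∪ … ∪ R_s^{(0)} we assign a cube □ having a common
point with this element and 3^d − 1 cubes neighbouring with □, then the sum of all these cubes contains the set ∪𝒞₀.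
It is so because a distance of each large block contained in Λ₀^{(0)c} from the set P_v^{(0)} ∪ … ∪ R_s^{(0)} is ≤ r(ε).
Thus we have |𝒞₀| ≤ 3^d(|P_v^{(0)}| + … + |R_s^{(0)}|). (3.44) … |𝒞_k| ≤ 3^d(|P_v^{(k)}| + … + |R_s^{(k)}|). (3.45)"*
p. 593 [PDF 39]: *"Let us take the kth term in (3.42) and let us notice that all the terms except ζ″_{Λ₀^{(k)}} depend on
Λ₀^{(k)c} … Each term of this function can be estimated by exp(−c₀p(L^kε)²|𝒞_k|), where c₀ = min{⅛a3^{−d}, ¼γ₀3^{−d},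
3^{−d}}, thus ζ″_{Λ₀^{(k)}}(the expressions dependent on Λ₀^{(k)c}) ≤ Σ_{all the subsets of Λ₀^{(k)c}} exp(−c₀p(L^kε)²|𝒞_k|)
(…) = 2^{6|Λ₀^{(k)c}|} exp(−c₀p(L^kε)²|𝒞_k|)(the expressions dependent on Λ₀^{(k)c}). (3.46)"*

DICTIONARY (continuing `B2Eq29Resummation`).  `S`, `β`, `N`, `W` (= Λ₀^{(k)c}), `minimals N W`, `outer N W` as there,
at the scale k (lattice T₁^{(k)}, radius r(L^kε)); `sort x : Fin 6` ↤ the sort of the element x (0 P_v, 1 Q_v, 2 R_v,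
3 P_s, 4 Q_s, 5 R_s); `a`, `γ₀` ↤ the constants a, γ₀; `pk` ↤ p(L^kε); `c x` ↤ the indicator χ^c_x (vector sorts, in
ζ′); `γ` ↤ the cubes of the regular partition, `cube b` ↤ the cube containing the large block b (*"each cube is a sum
of large blocks"*), `near x : Finset γ` ↤ *"a cube □ having a common point with this element and 3^d − 1 cubes
neighbouring with □"*, 𝒞 ↤ `W.image cube` (*"the cubes having common points with Λ₀^c"*).
-/

namespace Literature.MathematicalPhysics.QuantumFieldTheory.Balaban1983to89.B2Eq341Zeta

open Finset
open scoped Classical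
open B2Eq29Resummation

noncomputable section

variable {S β : Type*}

/-! ## The sorts and the printed coefficients of (3.34)/(3.41) -/

/-- The exponent coefficients of (3.41) per sort (0 P_v, 1 Q_v, 2 R_v, 3 P_s, 4 Q_s, 5 R_s): ⅛a, ¼γ₀, ¼γ₀, ⅛a, ¼γ₀, 1
(the factor of sort σ is exp(−coef·p(L^kε)²) per element). [cite: Balaban1982Higgs2, (3.41) p.592] -/
def coef341 (a γ₀ : ℝ) : Fin 6 → ℝ := ![a / 8, γ₀ / 4, γ₀ / 4, a / 8, γ₀ / 4, 1]

/-- The number of elements of sort σ in the tuple τ (|P_v^{(k)}|, …, |R_s^{(k)}| of the 6-tuple).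
[cite: Balaban1982Higgs2, (3.41) p.592] -/
def sortCard (sort : S → Fin 6) (τ : Finset S) (σ : Fin 6) : ℕ := (τ.filter fun x => sort x = σ).card

/-- |P_v| + |Q_v| + |R_v| + |P_s| + |Q_s| + |R_s| = the number of elements of the tuple.
[cite: Balaban1982Higgs2, (3.44) p.592] -/
theorem sum_sortCard (sort : S → Fin 6) (τ : Finset S) : ∑ σ, sortCard sort τ σ = τ.card := by
  unfold sortCard
  rw [Finset.card_eq_sum_card_fiberwise (f := sort) (t := Finset.univ) fun x _ => Finset.mem_univ _]

/-- The per-element factor of ζ″ (3.41): exp(−coef(sort x)·p(L^kε)²). [cite: Balaban1982Higgs2, (3.41) p.592] -/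
def weight341 (sort : S → Fin 6) (a γ₀ pk : ℝ) (x : S) : ℝ :=
  Real.exp (-(coef341 a γ₀ (sort x) * pk ^ 2))

/-- The per-element factor of ζ′ (3.34): the indicator χ^c_x for the vector sorts P_v, Q_v, R_v, and the small factors
exp(−⅛ap²), exp(−¼γ₀p²), exp(−p²) for the scalar sorts P_s, Q_s, R_s. [cite: Balaban1982Higgs2, (3.34) p.591] -/
def weight334 (sort : S → Fin 6) (c : S → ℝ) (a γ₀ pk : ℝ) (x : S) : ℝ :=
  if (sort x : ℕ) < 3 then c x else Real.exp (-(coef341 a γ₀ (sort x) * pk ^ 2))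

/-- Each summand of (3.41) IS the printed six-exponential `B2Sect3C.term341` evaluated at the sort counts of the
tuple. [cite: Balaban1982Higgs2, (3.41) p.592] -/
theorem prod_weight341 (sort : S → Fin 6) (a γ₀ pk : ℝ) (τ : Finset S) :
    ∏ x ∈ τ, weight341 sort a γ₀ pk x
      = B2Sect3C.term341 a γ₀ pk (sortCard sort τ 0) (sortCard sort τ 1) (sortCard sort τ 2)
          (sortCard sort τ 3) (sortCard sort τ 4) (sortCard sort τ 5) := by
  unfold weight341
  rw [← Real.exp_sum]
  have hsum : ∑ x ∈ τ, -(coef341 a γ₀ (sort x) * pk ^ 2)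
      = ∑ σ : Fin 6, -(coef341 a γ₀ σ * pk ^ 2) * (sortCard sort τ σ : ℝ) := by
    rw [← Finset.sum_fiberwise_of_maps_to (s := τ) (t := (Finset.univ : Finset (Fin 6))) (g := sort)
      fun x _ => Finset.mem_univ _]
    refine Finset.sum_congr rfl fun σ _ => ?_
    rw [Finset.sum_congr rfl fun x hx => by rw [(Finset.mem_filter.1 hx).2], Finset.sum_const, nsmul_eq_mul,
      mul_comm, sortCard]
  rw [hsum, Fin.sum_univ_six, B2Sect3C.term341, ← Real.exp_add, ← Real.exp_add, ← Real.exp_add, ← Real.exp_add,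
    ← Real.exp_add]
  congr 1
  simp [coef341]

variable [Fintype S]

/-- **(3.41)** p. 592: ζ″_{Λ₀^{(k)}} = Σ_{admissible, minimal} exp(−⅛ap(L^kε)²|P_v|)exp(−¼γ₀p²|Q_v|)exp(−¼γ₀p²|R_v|)
exp(−⅛ap²|P_s|)exp(−¼γ₀p²|Q_s|)exp(−p²|R_s|) — TYPED with body: the sum over the minimal admissible tuples of the
product of the per-element small factors (a pure number attached to W = Λ₀^{(k)c} and the constants; the per-scale
value is what the abstract carrier field `B2.Run.zeta` of Sect. 3.C records). [cite: Balaban1982Higgs2, (3.41) p.592] -/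
def zeta341 (N : S → Finset β) (W : Finset β) (sort : S → Fin 6) (a γ₀ pk : ℝ) : ℝ :=
  ∑ τ ∈ minimals N W, ∏ x ∈ τ, weight341 sort a γ₀ pk x

/-- **(3.34)** p. 591: ζ′_{Λ₀^{(k)}} = Σ_{admissible, minimal} χ^c_{P_v}χ^c_{Q_v}χ^c_{R_v}·exp(−⅛ap(L^kε)²|P_s|)
exp(−¼γ₀p²|Q_s|)exp(−p²|R_s|) — TYPED with body (a function of the vector-field configuration through the indicators
`c`: *"The functions ζ′ depend on the vector fields only"*). [cite: Balaban1982Higgs2, (3.34) p.591] -/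
def zeta334 (N : S → Finset β) (W : Finset β) (sort : S → Fin 6) (c : S → ℝ) (a γ₀ pk : ℝ) : ℝ :=
  ∑ τ ∈ minimals N W, ∏ x ∈ τ, weight334 sort c a γ₀ pk x

/-- Unfolding of ζ″ into the printed six-exponential terms. [cite: Balaban1982Higgs2, (3.41) p.592] -/
theorem zeta341_eq_sum_term341 (N : S → Finset β) (W : Finset β) (sort : S → Fin 6) (a γ₀ pk : ℝ) :
    zeta341 N W sort a γ₀ pk = ∑ τ ∈ minimals N W,
      B2Sect3C.term341 a γ₀ pk (sortCard sort τ 0) (sortCard sort τ 1) (sortCard sort τ 2)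
        (sortCard sort τ 3) (sortCard sort τ 4) (sortCard sort τ 5) := by
  unfold zeta341
  exact Finset.sum_congr rfl fun τ _ => prod_weight341 sort a γ₀ pk τ

/-- ζ″ ≥ 0. [cite: Balaban1982Higgs2, (3.41) p.592] -/
theorem zeta341_nonneg (N : S → Finset β) (W : Finset β) (sort : S → Fin 6) (a γ₀ pk : ℝ) :
    0 ≤ zeta341 N W sort a γ₀ pk :=
  Finset.sum_nonneg fun _ _ => Finset.prod_nonneg fun _ _ => (Real.exp_pos _).le

/-- From ζ′ to ζ″ (pp. 591–592: after (3.39)/(3.40) the vector-field indicators χ^c_{P_v}, χ^c_{Q_v}, χ^c_{R_v} are in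
turn traded for their small factors): if 0 ≤ χ^c_x ≤ exp(−coef(sort x)p²) is granted for the vector sorts, then
ζ′ ≤ ζ″ termwise. [cite: Balaban1982Higgs2, (3.41) p.592] -/
theorem zeta334_le_zeta341_of (N : S → Finset β) (W : Finset β) (sort : S → Fin 6) {c : S → ℝ} {a γ₀ pk : ℝ}
    (hc : ∀ x, 0 ≤ c x) (hle : ∀ x, (sort x : ℕ) < 3 → c x ≤ Real.exp (-(coef341 a γ₀ (sort x) * pk ^ 2))) :
    zeta334 N W sort c a γ₀ pk ≤ zeta341 N W sort a γ₀ pk := by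
  unfold zeta334 zeta341
  refine Finset.sum_le_sum fun τ _ => Finset.prod_le_prod (fun x _ => ?_) fun x _ => ?_
  · unfold weight334
    split_ifs
    · exact hc x
    · exact (Real.exp_pos _).le
  · unfold weight334 weight341
    split_ifs with h
    · exact hle x h
    · exact le_rfl

/-! ## (3.44)/(3.45): the covering count from ADMISSIBILITY; (3.46): the bound on ζ″ -/

omit [Fintype S] in
/-- **(3.44)/(3.45)** pp. 592–593 in the dictionary, PROVED: let every large block b lie in the cube `cube b` and let
`near x` (≤ 3^d cubes) contain the cube of every large block within r of the element x (*"a cube □ having a common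
point with this element and 3^d − 1 cubes neighbouring with □"*).  Then for every ADMISSIBLE tuple τ (Λ₀^c = ⋃_{x∈τ}
(blocks within r of x), *"It is so because a distance of each large block contained in Λ₀^c from the set P_v ∪ … ∪ R_s
is ≤ r(ε)"*) the set 𝒞 of cubes meeting Λ₀^c satisfies |𝒞| ≤ 3^d·|τ| = 3^d(|P_v| + … + |R_s|).
[cite: Balaban1982Higgs2, (3.44) p.592] -/
theorem card_cover_le {γ : Type*} {N : S → Finset β} {W : Finset β} (cube : β → γ) (near : S → Finset γ) {d : ℕ}
    (hnear : ∀ x, ∀ b ∈ N x, cube b ∈ near x) (hcard : ∀ x, (near x).card ≤ 3 ^ d) {τ : Finset S}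
    (hτ : Admissible N W τ) : (W.image cube).card ≤ 3 ^ d * τ.card := by
  have hsub : W.image cube ⊆ τ.biUnion near := by
    intro q hq
    obtain ⟨b, hb, rfl⟩ := Finset.mem_image.1 hq
    rw [← hτ] at hb
    obtain ⟨x, hx, hbx⟩ := mem_nbhd.1 hb
    exact Finset.mem_biUnion.2 ⟨x, hx, hnear x b hbx⟩
  calc (W.image cube).card ≤ (τ.biUnion near).card := Finset.card_le_card hsub
    _ ≤ ∑ x ∈ τ, (near x).card := Finset.card_biUnion_le
    _ ≤ ∑ _x ∈ τ, 3 ^ d := Finset.sum_le_sum fun x _ => hcard x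
    _ = 3 ^ d * τ.card := by rw [Finset.sum_const, smul_eq_mul, mul_comm]

omit [Fintype S] in
/-- (3.45) in the currency of `B2Sect3C.term341_le`: for an admissible tuple, |𝒞| ≤ 3^d(|P_v| + |Q_v| + |R_v| + |P_s| +
|Q_s| + |R_s|) as reals. [cite: Balaban1982Higgs2, (3.45) p.593] -/
theorem card_cover_le_sortCard {γ : Type*} {N : S → Finset β} {W : Finset β} (cube : β → γ) (near : S → Finset γ)
    {d : ℕ} (hnear : ∀ x, ∀ b ∈ N x, cube b ∈ near x) (hcard : ∀ x, (near x).card ≤ 3 ^ d) (sort : S → Fin 6)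
    {τ : Finset S} (hτ : Admissible N W τ) :
    ((W.image cube).card : ℝ) ≤ (3 : ℝ) ^ d *
      ((sortCard sort τ 0 : ℝ) + sortCard sort τ 1 + sortCard sort τ 2 + sortCard sort τ 3 +
        sortCard sort τ 4 + sortCard sort τ 5) := by
  have h := card_cover_le cube near hnear hcard hτ
  have hs : ((sortCard sort τ 0 : ℝ) + sortCard sort τ 1 + sortCard sort τ 2 + sortCard sort τ 3 +
      sortCard sort τ 4 + sortCard sort τ 5) = (τ.card : ℝ) := by
    rw [← sum_sortCard sort τ, Fin.sum_univ_six]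
    push_cast
    ring
  rw [hs]
  exact_mod_cast h

omit [Fintype S] in
/-- First half of **(3.46)** p. 593 for ONE term, PROVED: for an admissible tuple, its (3.41)-summand is
≤ exp(−c₀p(L^kε)²|𝒞|) with the printed c₀ = min{⅛a3^{−d}, ¼γ₀3^{−d}, 3^{−d}} = `B2.c0 a γ₀ d` (exponent arithmetic:
`B2Sect3C.term341_le`). [cite: Balaban1982Higgs2, (3.46) p.593] -/
theorem term341_le_of_admissible {γ : Type*} {N : S → Finset β} {W : Finset β} (cube : β → γ) (near : S → Finset γ)
    {d : ℕ} (hnear : ∀ x, ∀ b ∈ N x, cube b ∈ near x) (hcard : ∀ x, (near x).card ≤ 3 ^ d) (sort : S → Fin 6)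
    {a γ₀ : ℝ} (ha : 0 ≤ a) (hγ : 0 ≤ γ₀) (pk : ℝ) {τ : Finset S} (hτ : Admissible N W τ) :
    ∏ x ∈ τ, weight341 sort a γ₀ pk x ≤ Real.exp (-(B2.c0 a γ₀ d * pk ^ 2 * (W.image cube).card)) := by
  rw [prod_weight341]
  exact B2Sect3C.term341_le ha hγ (Nat.cast_nonneg _) (Nat.cast_nonneg _) (Nat.cast_nonneg _) (Nat.cast_nonneg _)
    (Nat.cast_nonneg _) (Nat.cast_nonneg _) (card_cover_le_sortCard cube near hnear hcard sort hτ)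

/-- The count of (3.46): at most 2^{#outer} minimal admissible tuples (outer = the elements whose r-neighbourhood of
large blocks stays inside Λ₀^c; the print counts *"all the subsets of Λ₀^{(k)c}"*, 2^{6|Λ₀^{(k)c}|}).
[cite: Balaban1982Higgs2, (3.46) p.593] -/
theorem card_minimals_le_two_pow (N : S → Finset β) (W : Finset β) :
    (minimals N W).card ≤ 2 ^ (outer N W).card := by
  have hsub : minimals N W ⊆ (outer N W).powerset := fun τ hτ =>
    Finset.mem_powerset.2 (mem_minimals.1 hτ).prop.subset_outer
  calc (minimals N W).card ≤ ((outer N W).powerset).card := Finset.card_le_card hsub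
    _ = 2 ^ (outer N W).card := Finset.card_powerset _

/-- **(3.46)** p. 593 for ζ″, PROVED in the dictionary: ζ″_{Λ₀^{(k)}} ≤ 2^{#outer}·exp(−c₀p(L^kε)²|𝒞_k|), from
`term341_le_of_admissible` for every minimal admissible tuple and the count `card_minimals_le_two_pow`.
[cite: Balaban1982Higgs2, (3.46) p.593] -/
theorem zeta341_le {γ : Type*} {N : S → Finset β} {W : Finset β} (cube : β → γ) (near : S → Finset γ) {d : ℕ}
    (hnear : ∀ x, ∀ b ∈ N x, cube b ∈ near x) (hcard : ∀ x, (near x).card ≤ 3 ^ d) (sort : S → Fin 6)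
    {a γ₀ : ℝ} (ha : 0 ≤ a) (hγ : 0 ≤ γ₀) (pk : ℝ) :
    zeta341 N W sort a γ₀ pk
      ≤ (2 : ℝ) ^ (outer N W).card * Real.exp (-(B2.c0 a γ₀ d * pk ^ 2 * (W.image cube).card)) := by
  unfold zeta341
  calc ∑ τ ∈ minimals N W, ∏ x ∈ τ, weight341 sort a γ₀ pk x
      ≤ ∑ _τ ∈ minimals N W, Real.exp (-(B2.c0 a γ₀ d * pk ^ 2 * (W.image cube).card)) :=
        Finset.sum_le_sum fun τ hτ =>
          term341_le_of_admissible cube near hnear hcard sort ha hγ pk (mem_minimals.1 hτ).prop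
    _ = (minimals N W).card * Real.exp (-(B2.c0 a γ₀ d * pk ^ 2 * (W.image cube).card)) := by
        rw [Finset.sum_const, nsmul_eq_mul]
    _ ≤ (2 : ℝ) ^ (outer N W).card * Real.exp (-(B2.c0 a γ₀ d * pk ^ 2 * (W.image cube).card)) := by
        refine mul_le_mul_of_nonneg_right ?_ (Real.exp_pos _).le
        exact_mod_cast card_minimals_le_two_pow N W

/-! ## v1.1 (gen 3 append): the cube hypotheses of (3.44)/(3.45) DISCHARGED in the Euclidean model of `B2Sect3C`
(elements and large blocks as points of ℝᵈ, cubes of side s indexed by ℤᵈ, sup-distance ≤ t < s) -/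

omit [Fintype S] in
/-- A point y lies in the cube of index (⌊y_i/s⌋)_i of the regular partition into cubes of side s (`B2Sect3C.cube`;
*"a regular partition of T₁ into a lattice of cubes"*, p. 592). [cite: Balaban1982Higgs2, (3.43) p.592] -/
theorem mem_cube_floor {s : ℝ} (hs : 0 < s) {d : ℕ} (y : Fin d → ℝ) :
    y ∈ B2Sect3C.cube s (fun i => ⌊y i / s⌋) := by
  intro i
  refine ⟨?_, ?_⟩
  · have h := Int.floor_le (y i / s)
    rwa [le_div_iff₀ hs] at h
  · have h := Int.lt_floor_add_one (y i / s)
    rwa [div_lt_iff₀ hs] at h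

omit [Fintype S] in
/-- In the Euclidean model the hypothesis `hnear` of `card_cover_le` HOLDS: if every large block of N x lies within
sup-distance t of the element x and t < s, the cube of that block is one of the 3ᵈ cubes `B2Sect3C.nbhd s (pos x)`
around x (`B2Sect3C.near_mem_nbhd`). [cite: Balaban1982Higgs2, (3.44) p.592] -/
theorem floorIdx_mem_nbhd {d : ℕ} {s t : ℝ} (hs : 0 < s) (hts : t < s) (pos : S → Fin d → ℝ)
    (posB : β → Fin d → ℝ) {N : S → Finset β} (hN : ∀ x, ∀ b ∈ N x, ∀ i, |posB b i - pos x i| ≤ t)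
    (x : S) (b : β) (hb : b ∈ N x) : (fun i => ⌊posB b i / s⌋) ∈ B2Sect3C.nbhd s (pos x) :=
  B2Sect3C.near_mem_nbhd hs hts ⟨posB b, mem_cube_floor hs (posB b), hN x b hb⟩

omit [Fintype S] in
/-- **(3.44)/(3.45) in the Euclidean model, PROVED**: for an admissible tuple τ, the cubes containing the large blocks of
Λ₀^c number ≤ 3ᵈ·|τ| — `card_cover_le` with its two hypotheses discharged by `B2Sect3C.near_mem_nbhd` and
`B2Sect3C.card_nbhd_le`. [cite: Balaban1982Higgs2, (3.45) p.593] -/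
theorem card_cover_le_euclid {d : ℕ} {s t : ℝ} (hs : 0 < s) (hts : t < s) (pos : S → Fin d → ℝ)
    (posB : β → Fin d → ℝ) {N : S → Finset β} {W : Finset β}
    (hN : ∀ x, ∀ b ∈ N x, ∀ i, |posB b i - pos x i| ≤ t) {τ : Finset S} (hτ : Admissible N W τ) :
    (W.image fun b => fun i => ⌊posB b i / s⌋).card ≤ 3 ^ d * τ.card := by
  convert card_cover_le (fun b => fun i => ⌊posB b i / s⌋) (fun x => B2Sect3C.nbhd s (pos x))
    (floorIdx_mem_nbhd hs hts pos posB hN) (fun x => B2Sect3C.card_nbhd_le s (pos x)) hτ using 3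

/-- **(3.46) in the Euclidean model, PROVED**: ζ″_{Λ₀^{(k)}} ≤ 2^{#outer}·exp(−c₀p(L^kε)²|𝒞_k|) with 𝒞_k = the cubes (side
s ∈ ]r, 2r[) containing the large blocks of Λ₀^{(k)c}, every block of N x within sup-distance t ≤ r < s of x.
[cite: Balaban1982Higgs2, (3.46) p.593] -/
theorem zeta341_le_euclid {d : ℕ} {s t : ℝ} (hs : 0 < s) (hts : t < s) (pos : S → Fin d → ℝ)
    (posB : β → Fin d → ℝ) {N : S → Finset β} {W : Finset β}
    (hN : ∀ x, ∀ b ∈ N x, ∀ i, |posB b i - pos x i| ≤ t) (sort : S → Fin 6) {a γ₀ : ℝ} (ha : 0 ≤ a)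
    (hγ : 0 ≤ γ₀) (pk : ℝ) :
    zeta341 N W sort a γ₀ pk ≤ (2 : ℝ) ^ (outer N W).card *
      Real.exp (-(B2.c0 a γ₀ d * pk ^ 2 * (W.image fun b => fun i => ⌊posB b i / s⌋).card)) := by
  convert zeta341_le (fun b => fun i => ⌊posB b i / s⌋) (fun x => B2Sect3C.nbhd s (pos x))
    (floorIdx_mem_nbhd hs hts pos posB hN) (fun x => B2Sect3C.card_nbhd_le s (pos x)) sort ha hγ pk using 6
  congr 2
  exact Subsingleton.elim _ _

end

end Literature.MathematicalPhysics.QuantumFieldTheory.Balaban1983to89.B2Eq341Zeta
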